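import Summits.ValiantsHypothesis.ValiantsHypothesis.Theorems.GrenetZeonDualUnipotentThreeHalvesHeavyTopCodimOneCount

/-!
# `GrenetZeon.DualUnipotentThreeHalves` (stmt-ValiantsHypothesis-24318), R2 heavy-top instrument — COROLLARY II port, step (c1):
# the EQUALITY CASE of the three-level graded count — `V` is the full HULL of its diagonal blocks

If the three-level count ✓ `…HeavyTopCodimOneCount.finrank_le_of_three_levels` is attained,
`dim W₀ + dim W₁ + dim W₂ + #{(i,j) : lvl j < lvl i} ≤ dim V`, then `V` is exactly the space of block upper-triangular matrices whose three
re-indexed diagonal blocks lie in `W₀`, `W₁`, `W₂` — the HULL `HULL(W₀, W₁, W₂)` for the level function `lvl` (all off-diagonal blocks free).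
In the classification (crux note `CENSUS-THMC-UNIFORM-eng1g5.md` §8, composition-chain route) this is the step «deficiency exactly one ⇒
`V = HULL(𝔫_p, I, 𝔫_q)`», before the block-diagonal unit and the re-indexing to ✓ `towerHull`.

* ★ `mem_iff_of_three_levels` — `A ∈ V ↔ (block upper-triangular) ∧ (blocks ∈ W₀, W₁, W₂)` under the attained count.

Honest framing: linear algebra; nothing here proves or refutes `HeavyTopLaw`, 24318, S3b or 8062; `VP ≠ VNP` is NOT proved.  No definitions.
[folklore (graded rank–nullity, equality case); cell val-heavytop-census, eng-1 g5]
-/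

noncomputable section

-- single-conjunct layout: Sub = Summit, duplicated namespace component intended
set_option linter.dupNamespace false

namespace Summit.ValiantsHypothesis.ValiantsHypothesis.Theorems.GrenetZeon.HeavyTopCodimOneCount

open Matrix

/-- ★ **Equality case of the three-level count: `V = HULL(W₀, W₁, W₂)`.**  If `dim W₀ + dim W₁ + dim W₂ + #{(i,j) : lvl j < lvl i} ≤ dim V`
for a block upper-triangular `V` (levels `≤ 2`) with diagonal blocks in `W₀, W₁, W₂`, then a matrix lies in `V` iff it is block upper-triangular
and its three re-indexed diagonal blocks lie in `W₀, W₁, W₂`. [folklore] -/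
theorem mem_iff_of_three_levels {m s₀ s₁ s₂ : ℕ} (lvl : Fin m → ℕ) (hlvl : ∀ i, lvl i ≤ 2)
    (e₀ : {i : Fin m // lvl i = 0} ≃ Fin s₀) (e₁ : {i : Fin m // lvl i = 1} ≃ Fin s₁) (e₂ : {i : Fin m // lvl i = 2} ≃ Fin s₂)
    (V : Submodule ℂ (Matrix (Fin m) (Fin m) ℂ)) (hblock : ∀ A ∈ V, ∀ i j, lvl i < lvl j → A i j = 0)
    (W₀ : Submodule ℂ (Matrix (Fin s₀) (Fin s₀) ℂ)) (W₁ : Submodule ℂ (Matrix (Fin s₁) (Fin s₁) ℂ))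
    (W₂ : Submodule ℂ (Matrix (Fin s₂) (Fin s₂) ℂ))
    (h₀ : ∀ A ∈ V, Matrix.reindex e₀ e₀ (A.toBlock (fun i => lvl i = 0) (fun i => lvl i = 0)) ∈ W₀)
    (h₁ : ∀ A ∈ V, Matrix.reindex e₁ e₁ (A.toBlock (fun i => lvl i = 1) (fun i => lvl i = 1)) ∈ W₁)
    (h₂ : ∀ A ∈ V, Matrix.reindex e₂ e₂ (A.toBlock (fun i => lvl i = 2) (fun i => lvl i = 2)) ∈ W₂)
    (hdim : Module.finrank ℂ W₀ + Module.finrank ℂ W₁ + Module.finrank ℂ W₂ + Fintype.card {x : Fin m × Fin m // lvl x.2 < lvl x.1} ≤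
      Module.finrank ℂ V)
    (M : Matrix (Fin m) (Fin m) ℂ) :
    M ∈ V ↔ (∀ i j, lvl i < lvl j → M i j = 0) ∧
      Matrix.reindex e₀ e₀ (M.toBlock (fun i => lvl i = 0) (fun i => lvl i = 0)) ∈ W₀ ∧
      Matrix.reindex e₁ e₁ (M.toBlock (fun i => lvl i = 1) (fun i => lvl i = 1)) ∈ W₁ ∧
      Matrix.reindex e₂ e₂ (M.toBlock (fun i => lvl i = 2) (fun i => lvl i = 2)) ∈ W₂ := by
  classical
  refine ⟨fun hM => ⟨hblock M hM, h₀ M hM, h₁ M hM, h₂ M hM⟩, ?_⟩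
  rintro ⟨hMb, hM₀, hM₁, hM₂⟩
  -- the diagonal-block map (as in `finrank_le_of_three_levels`)
  let D : V →ₗ[ℂ] (W₀ × W₁) × W₂ :=
    { toFun := fun A =>
        ((⟨Matrix.reindex e₀ e₀ ((A : Matrix (Fin m) (Fin m) ℂ).toBlock (fun i => lvl i = 0) (fun i => lvl i = 0)), h₀ A A.2⟩,
          ⟨Matrix.reindex e₁ e₁ ((A : Matrix (Fin m) (Fin m) ℂ).toBlock (fun i => lvl i = 1) (fun i => lvl i = 1)), h₁ A A.2⟩),
          ⟨Matrix.reindex e₂ e₂ ((A : Matrix (Fin m) (Fin m) ℂ).toBlock (fun i => lvl i = 2) (fun i => lvl i = 2)), h₂ A A.2⟩)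
      map_add' := fun A B => by
        refine Prod.ext (Prod.ext (Subtype.ext ?_) (Subtype.ext ?_)) (Subtype.ext ?_) <;> ext a b <;> rfl
      map_smul' := fun c A => by
        refine Prod.ext (Prod.ext (Subtype.ext ?_) (Subtype.ext ?_)) (Subtype.ext ?_) <;> ext a b <;> rfl }
  have hker : ∀ A : V, D A = 0 → ∀ i j, ¬ lvl j < lvl i → (A : Matrix (Fin m) (Fin m) ℂ) i j = 0 := by
    intro A hA
    have g₀ := congrArg (fun x => ((x.1.1 : W₀) : Matrix (Fin s₀) (Fin s₀) ℂ)) hA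
    have g₁ := congrArg (fun x => ((x.1.2 : W₁) : Matrix (Fin s₁) (Fin s₁) ℂ)) hA
    have g₂ := congrArg (fun x => ((x.2 : W₂) : Matrix (Fin s₂) (Fin s₂) ℂ)) hA
    exact entry_eq_zero_of_blocks_eq_zero lvl hlvl e₀ e₁ e₂ A (hblock A A.2) g₀ g₁ g₂
  let F : LinearMap.ker D →ₗ[ℂ] ({x : Fin m × Fin m // lvl x.2 < lvl x.1} → ℂ) :=
    { toFun := fun A x => ((A : V) : Matrix (Fin m) (Fin m) ℂ) x.1.1 x.1.2
      map_add' := fun A B => by funext x; rfl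
      map_smul' := fun c A => by funext x; rfl }
  have hF : Function.Injective F := by
    intro A B hAB
    apply Subtype.ext
    apply Subtype.ext
    ext i j
    by_cases hij : lvl j < lvl i
    · exact congrFun hAB ⟨(i, j), hij⟩
    · rw [hker A.1 (LinearMap.mem_ker.1 A.2) i j hij, hker B.1 (LinearMap.mem_ker.1 B.2) i j hij]
  -- the count is attained: `D` is onto and `F` is a bijection
  have h1 := LinearMap.finrank_range_add_finrank_ker D
  have h2 : Module.finrank ℂ (LinearMap.range D) ≤ Module.finrank ℂ ((W₀ × W₁) × W₂) := Submodule.finrank_le _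
  have h3 := LinearMap.finrank_le_finrank_of_injective hF
  rw [Module.finrank_fintype_fun_eq_card] at h3
  have hprod : Module.finrank ℂ ((W₀ × W₁) × W₂) = Module.finrank ℂ W₀ + Module.finrank ℂ W₁ + Module.finrank ℂ W₂ := by
    rw [Module.finrank_prod, Module.finrank_prod]
  have hrange : LinearMap.range D = ⊤ := Submodule.eq_top_of_finrank_eq (by omega)
  have hEq : Module.finrank ℂ (LinearMap.ker D) = Module.finrank ℂ ({x : Fin m × Fin m // lvl x.2 < lvl x.1} → ℂ) := by
    rw [Module.finrank_fintype_fun_eq_card]; omega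
  have hrangeF : LinearMap.range F = ⊤ :=
    Submodule.eq_top_of_finrank_eq (by rw [LinearMap.finrank_range_of_inj hF]; exact hEq)
  have hFs : Function.Surjective F := LinearMap.range_eq_top.1 hrangeF
  -- a member `B` of `V` with the diagonal blocks of `M`
  have hmem : (((⟨Matrix.reindex e₀ e₀ (M.toBlock (fun i => lvl i = 0) (fun i => lvl i = 0)), hM₀⟩,
        ⟨Matrix.reindex e₁ e₁ (M.toBlock (fun i => lvl i = 1) (fun i => lvl i = 1)), hM₁⟩),
        ⟨Matrix.reindex e₂ e₂ (M.toBlock (fun i => lvl i = 2) (fun i => lvl i = 2)), hM₂⟩) : (W₀ × W₁) × W₂) ∈ LinearMap.range D := by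
    rw [hrange]; exact Submodule.mem_top
  obtain ⟨B, hB⟩ := LinearMap.mem_range.1 hmem
  have hB₀ : Matrix.reindex e₀ e₀ ((B : Matrix (Fin m) (Fin m) ℂ).toBlock (fun i => lvl i = 0) (fun i => lvl i = 0)) =
      Matrix.reindex e₀ e₀ (M.toBlock (fun i => lvl i = 0) (fun i => lvl i = 0)) :=
    congrArg (fun x => ((x.1.1 : W₀) : Matrix (Fin s₀) (Fin s₀) ℂ)) hB
  have hB₁ : Matrix.reindex e₁ e₁ ((B : Matrix (Fin m) (Fin m) ℂ).toBlock (fun i => lvl i = 1) (fun i => lvl i = 1)) =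
      Matrix.reindex e₁ e₁ (M.toBlock (fun i => lvl i = 1) (fun i => lvl i = 1)) :=
    congrArg (fun x => ((x.1.2 : W₁) : Matrix (Fin s₁) (Fin s₁) ℂ)) hB
  have hB₂ : Matrix.reindex e₂ e₂ ((B : Matrix (Fin m) (Fin m) ℂ).toBlock (fun i => lvl i = 2) (fun i => lvl i = 2)) =
      Matrix.reindex e₂ e₂ (M.toBlock (fun i => lvl i = 2) (fun i => lvl i = 2)) :=
    congrArg (fun x => ((x.2 : W₂) : Matrix (Fin s₂) (Fin s₂) ℂ)) hB
  -- `N := M - B` is block upper-triangular with vanishing diagonal blocks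
  have hNb : ∀ i j, lvl i < lvl j → (M - (B : Matrix (Fin m) (Fin m) ℂ)) i j = 0 := fun i j hij => by
    rw [Matrix.sub_apply, hMb i j hij, hblock B B.2 i j hij, sub_zero]
  have hN₀ : Matrix.reindex e₀ e₀ ((M - (B : Matrix (Fin m) (Fin m) ℂ)).toBlock (fun i => lvl i = 0) (fun i => lvl i = 0)) = 0 := by
    ext a b
    have := congrFun (congrFun hB₀ a) b
    rw [Matrix.reindex_apply, Matrix.reindex_apply, Matrix.submatrix_apply, Matrix.submatrix_apply, Matrix.toBlock_apply,
      Matrix.toBlock_apply] at this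
    rw [Matrix.reindex_apply, Matrix.submatrix_apply, Matrix.toBlock_apply, Matrix.sub_apply, ← this, sub_self, Matrix.zero_apply]
  have hN₁ : Matrix.reindex e₁ e₁ ((M - (B : Matrix (Fin m) (Fin m) ℂ)).toBlock (fun i => lvl i = 1) (fun i => lvl i = 1)) = 0 := by
    ext a b
    have := congrFun (congrFun hB₁ a) b
    rw [Matrix.reindex_apply, Matrix.reindex_apply, Matrix.submatrix_apply, Matrix.submatrix_apply, Matrix.toBlock_apply,
      Matrix.toBlock_apply] at this
    rw [Matrix.reindex_apply, Matrix.submatrix_apply, Matrix.toBlock_apply, Matrix.sub_apply, ← this, sub_self, Matrix.zero_apply]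
  have hN₂ : Matrix.reindex e₂ e₂ ((M - (B : Matrix (Fin m) (Fin m) ℂ)).toBlock (fun i => lvl i = 2) (fun i => lvl i = 2)) = 0 := by
    ext a b
    have := congrFun (congrFun hB₂ a) b
    rw [Matrix.reindex_apply, Matrix.reindex_apply, Matrix.submatrix_apply, Matrix.submatrix_apply, Matrix.toBlock_apply,
      Matrix.toBlock_apply] at this
    rw [Matrix.reindex_apply, Matrix.submatrix_apply, Matrix.toBlock_apply, Matrix.sub_apply, ← this, sub_self, Matrix.zero_apply]
  have hNoff := entry_eq_zero_of_blocks_eq_zero lvl hlvl e₀ e₁ e₂ _ hNb hN₀ hN₁ hN₂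
  -- a kernel member `C` with the pattern entries of `N`; then `C = N`
  obtain ⟨C, hC⟩ := hFs fun x => (M - (B : Matrix (Fin m) (Fin m) ℂ)) x.1.1 x.1.2
  have hCN : (((C : LinearMap.ker D) : V) : Matrix (Fin m) (Fin m) ℂ) = M - (B : Matrix (Fin m) (Fin m) ℂ) := by
    ext i j
    by_cases hij : lvl j < lvl i
    · exact congrFun hC ⟨(i, j), hij⟩
    · rw [hker C.1 (LinearMap.mem_ker.1 C.2) i j hij, hNoff i j hij]
  have hMeq : M = (M - (B : Matrix (Fin m) (Fin m) ℂ)) + (B : Matrix (Fin m) (Fin m) ℂ) := by rw [sub_add_cancel]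
  rw [hMeq, ← hCN]
  exact V.add_mem (C : V).2 B.2

end Summit.ValiantsHypothesis.ValiantsHypothesis.Theorems.GrenetZeon.HeavyTopCodimOneCount

end
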